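import Mathlib

/-!
# Laplace optimality of the permutation pattern and the general tied block — definitions
# (crux `RankRigidMinimalRepr`, stmt-ValiantsHypothesis-18034, route `RigidityForcesSymmetry`)

The ENGINE behind the landed level counts `stub_levelBound` (two tied columns, `…StubLevelBound.lean`) and
`levelBound_threeTied` (three, `…LevelBoundThreeTied.lean`) is one double count whose only tie-dependent input is a
FINITE statement about the permutation pattern of order `d = k + 1` (the number of tied columns).  This file names the
two objects of the general engine (`…LevelBoundOfLaplace.lean`):

* `tauD hd σ v` — for `σ ∈ 𝔖_m`, `d ≤ m` and an assignment `v : Fin d → Fin d`, the self-map of `[m]` that agrees with `σ`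
  on the rows `x` with `σ x` untied (`d ≤ σ x`) and sends the tied row `σ⁻¹ i` (`i < d`) to the tied column `v i`.  Its
  `d^d` graph monomials form the BLOCK of `σ`; on the block the permanent is the PERMUTATION PATTERN `[v injective]`.
* `LaplaceOptimal d` — «LAPLACE EXPANSION IS OPTIMAL for the permutation pattern of order `d`»: whenever the pattern
  `v ↦ [v injective]` on `Fin d → Fin d` is written as a finite sum of SPLIT-RANK-ONE terms `u_t(v) · w_t(v)` with `u_t`
  depending only on `v|_{S_t}` and `w_t` only on `v|_{S_tᶜ}` (`S_t ⊆ Fin d` arbitrary, the trivial splits allowed), the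
  weights `|S_t|! · (d - |S_t|)!` sum to at least `d!`.  Laplace expansion along any `r`-set `S` (`C(d, r)` terms of
  weight `r!(d-r)!`) shows the bound is tight.  `LaplaceOptimal 2` and `LaplaceOptimal 3` hold (rank of `[[0,1],[1,0]]`;
  slice rank of `P_3`, `…PermPatternThree.lean`); `LaplaceOptimal 4` is open here.

The engine proves `LaplaceOptimal (k + 1) → TiedLevelDecomposable m k s w → C(m, s) ≤ w` (for `k + 1 ≤ m`, `s ≤ m`).
CAVEAT: `LaplaceOptimal d` for all `d` would yield Grenet-optimality for representations equivariant under the left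
torus alone (unordered set-multilinear ABP lower bounds for the permanent, an open problem), so these finite statements
must become hard as `d` grows.  HONEST FRAMING: definitions only; nothing of the crux or of `VP ≠ VNP` is asserted.
-/

set_option autoImplicit false

-- the mandated summit-side namespace repeats a component by design (single-problem summit)
set_option linter.dupNamespace false

namespace Summit.ValiantsHypothesis.ValiantsHypothesis.Theorems.RigidityForcesSymmetryRankRigidMinimalRepr

/-- The BLOCK MAP of a permutation: for `σ ∈ 𝔖_m`, `d ≤ m` and `v : Fin d → Fin d`, the self-map of `[m]` sending a row
`x` with `σ x` tied (`σ x < d`) to the tied column `v (σ x)` and agreeing with `σ` elsewhere (`σ[σ⁻¹ i ↦ v i, i < d]`).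
For `d = 2` this is `tau σ (v 0) (v 1)` of `…BlockDefs.lean`, for `d = 3` it is `tau₃ σ (v 0) (v 1) (v 2)`. -/
def tauD {d m : ℕ} (hd : d ≤ m) (σ : Equiv.Perm (Fin m)) (v : Fin d → Fin d) : Fin m → Fin m :=
  fun x => if h : (σ x).val < d then Fin.castLE hd (v ⟨(σ x).val, h⟩) else σ x

/-- **Laplace optimality of the permutation pattern of order `d`** (a weighted partition-rank bound): for every
finite family of split-rank-one terms `u_t(v) · w_t(v)` — `u_t` a function of `v|_{S_t}`, `w_t` a function of
`v|_{(S_t)ᶜ}` — summing to the pattern `[v injective]` on `Fin d → Fin d`, the weights `|S_t|! (d - |S_t|)!` sum to at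
least `d!`.  Tight for the Laplace expansion along any set of positions.  Known here for `d ≤ 3`; open for `d ≥ 4`. -/
def LaplaceOptimal (d : ℕ) : Prop :=
  ∀ (N : ℕ) (T : Finset (Fin N)) (S : Fin N → Finset (Fin d)) (u w : Fin N → (Fin d → Fin d) → ℂ),
    (∀ t, ∀ v v' : Fin d → Fin d, (∀ i ∈ S t, v i = v' i) → u t v = u t v') →
    (∀ t, ∀ v v' : Fin d → Fin d, (∀ i, i ∉ S t → v i = v' i) → w t v = w t v') →
    (∀ v : Fin d → Fin d, (∑ t ∈ T, u t v * w t v) = if Function.Injective v then 1 else 0) →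
    d.factorial ≤ ∑ t ∈ T, (S t).card.factorial * (d - (S t).card).factorial

end Summit.ValiantsHypothesis.ValiantsHypothesis.Theorems.RigidityForcesSymmetryRankRigidMinimalRepr
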